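import Mathlib
import HarnessLib

/-!
# Errors for integrands with low continuity, through approximation theory (Davis–Rabinowitz 1984, Sect. 4.8)

Davis–Rabinowitz, *Methods of Numerical Integration* (2nd ed., 1984), Sect. 4.8, pp. 332–333.  "What is
the error when a high-order rule is applied to a function with low-order continuity?"  Besides Peano's theorem
with a low `n` (Sect. 4.3), the book gives the approximation-theoretic answer:

* **Theorem (4.8.1)–(4.8.3)** `abs_integral_sub_sum_le_of_near_polynomial`: if `R(f) = Σ w_k f(x_k)`
  (`a ≤ x_k ≤ b`) is exact for `𝒫_n` and `|f - p_n| ≤ ε` on `[a, b]` for some `p_n ∈ 𝒫_n`, then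
  `|E(f)| = |∫_a^b f - R(f)| ≤ [(b - a) + Σ |w_k|] ε`;
* **Corollary (4.8.4)** `abs_integral_sub_sum_le_of_near_polynomial_of_nonneg`: for non-negative weights
  `Σ |w_k| = Σ w_k = b - a` (`sum_weights_eq_sub_of_exact`), hence `|E(f)| ≤ 2(b - a)ε`;
* **Jackson's theorem (4.8.7)** for integrands with a bounded derivative is recorded as the NAMED FACT
  `JacksonBoundedDeriv` (Jackson's theorems are not in Mathlib) and used only as a hypothesis in
  `abs_integral_sub_sum_le_of_deriv_bound`: `|E(f)| ≤ 6(b - a)²M/n` for a non-negative rule exact on `𝒫_n`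
  and `|f'| ≤ M` — the book's pipeline behind its Example (`f = x^{3/2}`, Gauss rules: `9/(2n - 1)`).

Rules are point-evaluation functionals with weights `w : ι → ℝ` and nodes `x : ι → ℝ` over a `Fintype`, as in
the other quadrature anchors of this directory; exactness is stated on `Polynomial.natDegree ≤ n`.

Provenance: engines group, shared numerical engines serving client cells; rigour lives in the verifiers; every
published number belongs to a client cell's ledger, not to the engines group.  This file records textbook
facts only (no client numbers).
-/

namespace Literature.Analysis.Quadrature

open Set MeasureTheory intervalIntegral Finset Polynomial
open scoped Real Interval

noncomputable section

variable {ι : Type*} [Fintype ι]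

/-- **Theorem (4.8.1)–(4.8.3)** (errors for integrands with low continuity, through approximation theory):
let `R(f) = Σ_k w_k f(x_k)`, `a ≤ x_k ≤ b`, be exact for `𝒫_n`, and let `p_n ∈ 𝒫_n` satisfy
`|f(x) - p_n(x)| ≤ ε` on `[a, b]` (4.8.1). Then `E(f) = ∫_a^b f - R(f)` (4.8.2) satisfies
`|E(f)| ≤ [(b - a) + Σ_k |w_k|] ε` (4.8.3).  (Proof as in the book: `E(f) = ∫ (f - p_n) + R(p_n - f)`.)
The book takes `f ∈ C[a, b]`; interval integrability is what is used.
[cite: DavisRabinowitz1984, Sect. 4.8 (4.8.3)] -/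
theorem abs_integral_sub_sum_le_of_near_polynomial {w x : ι → ℝ} {a b : ℝ} (hab : a ≤ b)
    (hx : ∀ i, x i ∈ Icc a b) {n : ℕ}
    (hexact : ∀ q : ℝ[X], q.natDegree ≤ n → ∫ t in a..b, q.eval t = ∑ i, w i * q.eval (x i))
    {f : ℝ → ℝ} (hfi : IntervalIntegrable f volume a b) {p : ℝ[X]} (hp : p.natDegree ≤ n) {ε : ℝ}
    (hε : ∀ t ∈ Icc a b, |f t - p.eval t| ≤ ε) :
    |(∫ t in a..b, f t) - ∑ i, w i * f (x i)| ≤ ((b - a) + ∑ i, |w i|) * ε := by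
  have hpi : IntervalIntegrable (fun t => p.eval t) volume a b := p.continuous.intervalIntegrable _ _
  -- `E(f) = ∫ (f - p) + Σ w_i (p(x_i) - f(x_i))`
  have hE : (∫ t in a..b, f t) - ∑ i, w i * f (x i) =
      (∫ t in a..b, (f t - p.eval t)) + ∑ i, w i * (p.eval (x i) - f (x i)) := by
    rw [intervalIntegral.integral_sub hfi hpi, hexact p hp]
    simp only [mul_sub, Finset.sum_sub_distrib]
    ring
  rw [hE]
  -- the integral term
  have h1 : |∫ t in a..b, (f t - p.eval t)| ≤ ε * (b - a) := by
    have h := intervalIntegral.norm_integral_le_of_norm_le_const (a := a) (b := b) (C := ε)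
      (f := fun t => f t - p.eval t) (fun t ht => ?_)
    · rw [abs_of_nonneg (sub_nonneg.2 hab)] at h
      simpa only [Real.norm_eq_abs] using h
    · rw [uIoc_of_le hab] at ht
      simpa only [Real.norm_eq_abs] using hε t (Ioc_subset_Icc_self ht)
  -- the rule term
  have h2 : |∑ i, w i * (p.eval (x i) - f (x i))| ≤ (∑ i, |w i|) * ε := by
    refine (Finset.abs_sum_le_sum_abs _ _).trans ?_
    rw [Finset.sum_mul]
    refine Finset.sum_le_sum fun i _ => ?_
    rw [abs_mul]
    refine mul_le_mul_of_nonneg_left ?_ (abs_nonneg _)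
    rw [abs_sub_comm]
    exact hε (x i) (hx i)
  calc |(∫ t in a..b, (f t - p.eval t)) + ∑ i, w i * (p.eval (x i) - f (x i))|
      ≤ |∫ t in a..b, (f t - p.eval t)| + |∑ i, w i * (p.eval (x i) - f (x i))| := abs_add_le _ _
    _ ≤ ε * (b - a) + (∑ i, |w i|) * ε := add_le_add h1 h2
    _ = ((b - a) + ∑ i, |w i|) * ε := by ring

/-- For a rule exact for constants, `Σ_k w_k = b - a` ("`Σ w_k = ∫_a^b dx = b - a`", proof of (4.8.4)).
[cite: DavisRabinowitz1984, Sect. 4.8 (4.8.4)] -/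
theorem sum_weights_eq_sub_of_exact {w x : ι → ℝ} {a b : ℝ} {n : ℕ}
    (hexact : ∀ q : ℝ[X], q.natDegree ≤ n → ∫ t in a..b, q.eval t = ∑ i, w i * q.eval (x i)) :
    ∑ i, w i = b - a := by
  have h := hexact (C 1) (by simp)
  simp only [eval_C, intervalIntegral.integral_const, smul_eq_mul, mul_one] at h
  exact h.symm

/-- **Corollary (4.8.4)**: if moreover the weights are non-negative (the book: `w_k > 0`), then
`Σ |w_k| = Σ w_k = b - a` and `|E(f)| ≤ 2(b - a)ε`. [cite: DavisRabinowitz1984, Sect. 4.8 (4.8.4)] -/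
theorem abs_integral_sub_sum_le_of_near_polynomial_of_nonneg {w x : ι → ℝ} {a b : ℝ} (hab : a ≤ b)
    (hx : ∀ i, x i ∈ Icc a b) (hw : ∀ i, 0 ≤ w i) {n : ℕ}
    (hexact : ∀ q : ℝ[X], q.natDegree ≤ n → ∫ t in a..b, q.eval t = ∑ i, w i * q.eval (x i))
    {f : ℝ → ℝ} (hfi : IntervalIntegrable f volume a b) {p : ℝ[X]} (hp : p.natDegree ≤ n) {ε : ℝ}
    (hε : ∀ t ∈ Icc a b, |f t - p.eval t| ≤ ε) :
    |(∫ t in a..b, f t) - ∑ i, w i * f (x i)| ≤ 2 * (b - a) * ε := by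
  have h := abs_integral_sub_sum_le_of_near_polynomial hab hx hexact hfi hp hε
  have hs : ∑ i, |w i| = b - a := by
    rw [← sum_weights_eq_sub_of_exact hexact]
    exact Finset.sum_congr rfl fun i _ => abs_of_nonneg (hw i)
  rw [hs] at h
  linarith

/-- **Jackson's theorem for an integrand with a bounded derivative (4.8.7)** — NAMED FACT (Jackson's theorems
(4.8.5)–(4.8.9) are not in Mathlib): if `|f'(x)| ≤ M` on `[a, b]` then for each `n = 1, 2, …` there is
`p_n ∈ 𝒫_n` with `|f(x) - p_n(x)| ≤ 3(b - a)M/n` on `[a, b]`.  Used below only as a hypothesis.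
[cite: DavisRabinowitz1984, Sect. 4.8 (4.8.7)] -/
def JacksonBoundedDeriv : Prop :=
  ∀ (a b : ℝ), a ≤ b → ∀ (f f' : ℝ → ℝ) (M : ℝ), (∀ x ∈ Icc a b, HasDerivAt f (f' x) x) →
    (∀ x ∈ Icc a b, |f' x| ≤ M) → ∀ n : ℕ, 0 < n →
      ∃ p : ℝ[X], p.natDegree ≤ n ∧ ∀ x ∈ Icc a b, |f x - p.eval x| ≤ 3 * (b - a) * M / n

/-- **(4.8.4) with (4.8.7)** (the book's pipeline, cf. its Example `f = x^{3/2}` and the Gauss rules): a rule with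
non-negative weights, nodes in `[a, b]`, exact for `𝒫_n` (`n ≥ 1`), applied to `f` with `|f'| ≤ M` on `[a, b]`,
has `|E(f)| ≤ 2(b - a) · 3(b - a)M/n = 6(b - a)²M/n` — conditional on Jackson's theorem (4.8.7).
[cite: DavisRabinowitz1984, Sect. 4.8 (4.8.4)] [cite: DavisRabinowitz1984, Sect. 4.8 (4.8.7)] -/
theorem abs_integral_sub_sum_le_of_deriv_bound (hJ : JacksonBoundedDeriv) {w x : ι → ℝ} {a b : ℝ}
    (hab : a ≤ b) (hx : ∀ i, x i ∈ Icc a b) (hw : ∀ i, 0 ≤ w i) {n : ℕ} (hn : 0 < n)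
    (hexact : ∀ q : ℝ[X], q.natDegree ≤ n → ∫ t in a..b, q.eval t = ∑ i, w i * q.eval (x i))
    {f f' : ℝ → ℝ} (hf : ∀ t ∈ Icc a b, HasDerivAt f (f' t) t) {M : ℝ} (hM : ∀ t ∈ Icc a b, |f' t| ≤ M) :
    |(∫ t in a..b, f t) - ∑ i, w i * f (x i)| ≤ 6 * (b - a) ^ 2 * M / n := by
  obtain ⟨p, hp, hε⟩ := hJ a b hab f f' M hf hM n hn
  have hfi : IntervalIntegrable f volume a b := by
    refine ContinuousOn.intervalIntegrable fun t ht => ?_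
    rw [uIcc_of_le hab] at ht
    exact (hf t ht).continuousAt.continuousWithinAt
  have h := abs_integral_sub_sum_le_of_near_polynomial_of_nonneg hab hx hw hexact hfi hp hε
  calc |(∫ t in a..b, f t) - ∑ i, w i * f (x i)| ≤ 2 * (b - a) * (3 * (b - a) * M / n) := h
    _ = 6 * (b - a) ^ 2 * M / n := by ring

end

end Literature.Analysis.Quadrature
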